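import Mathlib.NumberTheory.DirichletCharacter.Orthogonality
import Mathlib.NumberTheory.DirichletCharacter.Bounds
import Mathlib.Analysis.SpecialFunctions.Pow.Real
import Mathlib.Analysis.SpecialFunctions.Sqrt
import Mathlib.Analysis.Complex.Basic
import Mathlib.Topology.Algebra.InfiniteSum.Order
import HarnessLib

/-!
# Tools for Saias–Weingartner 2009, Lemma 1: tiers, the two-circle linkage, character inversion

Topic `Literature/NumberTheory/LFunctions` (namespace `Literature.NumberTheory.LFunctions`,
sub-namespace `SaiasWeingartner`). Everything here is PROVED. Saias–Weingartner's Lemma 1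
(arXiv:0807.0783, §3) solves, continuously in a parameter, the linear system
`∑_{p > y} χⱼ(p) p^{-σ - it_p} = zⱼ` in the phases `p^{-it_p}`. Its three ingredients:

* `exists_tiers` — **three tiers**: a summable sequence `0 ≤ uₙ ≤ 1` with sum `S ≥ 100` splits
  as `∑_{n < N₁} + ∑_{N₁ ≤ n < N₂} + ∑_{n ≥ N₂}` with the first two block sums in `[S/3, S/3 + 1]`
  ("there exist prime numbers `p_{1,a}` and `p_{2,a}`, such that `1/3 ≤ λ₀ ≤ 1/3 + 1/100` and
  `1/3 ≤ λ₁ ≤ 1/3 + 1/100`");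
* `exists_twoCircle` — **the two-circle linkage**: for `a, b > 0` there are functions `ε₁, ε₂`,
  continuous on `ℂ ∖ {0}`, with `|ε₁(c)| = |ε₂(c)| = 1` and `a ε₁(c) + b ε₂(c) = c` whenever
  `|‖c‖ − a| ≤ b ≤ ‖c‖ + a` (the source solves `λ₁ e^{iu₁} + λ₂ e^{-iu₂} = λ₀ − w_a/S_a`
  continuously; here by the law of cosines);
* `sum_char_mul_charInv_transform` — **inverting the character matrix**: for pairwise distinct
  Dirichlet characters `ψⱼ mod q`, the vector `W_a = φ(q)⁻¹ ∑ⱼ ψⱼ⁻¹(a) wⱼ` satisfies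
  `∑_a ψᵢ(a) W_a = wᵢ` ("we denote by `C` the unitary matrix of the characters modulo `q` … to
  change variables we write `z = Cw`"; orthogonality, Mathlib's `MulChar.sum_eq_zero_of_ne_one`),
  with `‖W_a‖ ≤ ∑ⱼ ‖wⱼ‖` (`norm_charInv_transform_le`).

## References

* [SaiasWeingartner2009] E. Saias, A. Weingartner, *Zeros of Dirichlet series with periodic
  coefficients*, Acta Arith. 140 (2009), 335–344, Lemma 1 and its proof (read, arXiv:0807.0783,
  p. 6).
-/

noncomputable section

open Complex Finset Filter Topology

namespace Literature.NumberTheory.LFunctions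

namespace SaiasWeingartner

/-! ### Three tiers -/

/-- Partial sums of a non-negative sequence are monotone. [folklore] -/
theorem sum_range_mono {u : ℕ → ℝ} (hu0 : ∀ n, 0 ≤ u n) {M N : ℕ} (h : M ≤ N) :
    ∑ n ∈ range M, u n ≤ ∑ n ∈ range N, u n :=
  sum_le_sum_of_subset_of_nonneg (range_mono h) fun n _ _ ↦ hu0 n

/-- **Three tiers** (the choice of `p_{1,a}`, `p_{2,a}` in the proof of Lemma 1): a summable
sequence `0 ≤ uₙ ≤ 1` with sum `S ≥ 100` has cut points `N₁ ≤ N₂` with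
`S/3 ≤ ∑_{n<N₁} uₙ ≤ S/3 + 1` and `S/3 ≤ ∑_{N₁ ≤ n < N₂} uₙ ≤ S/3 + 1`.
[cite: SaiasWeingartner2009, Lemma 1 (proof)] -/
theorem exists_tiers {u : ℕ → ℝ} (hu0 : ∀ n, 0 ≤ u n) (hu1 : ∀ n, u n ≤ 1) (hsum : Summable u)
    (hS : 100 ≤ ∑' n, u n) :
    ∃ N₁ N₂ : ℕ, N₁ ≤ N₂ ∧
      (∑' n, u n) / 3 ≤ ∑ n ∈ range N₁, u n ∧ ∑ n ∈ range N₁, u n ≤ (∑' n, u n) / 3 + 1 ∧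
      (∑' n, u n) / 3 ≤ ∑ n ∈ Ico N₁ N₂, u n ∧ ∑ n ∈ Ico N₁ N₂, u n ≤ (∑' n, u n) / 3 + 1 := by
  classical
  set S : ℝ := ∑' n, u n with hSdef
  set P : ℕ → ℝ := fun N ↦ ∑ n ∈ range N, u n with hP
  have htend : Tendsto P atTop (𝓝 S) := hsum.hasSum.tendsto_sum_nat
  have hstep : ∀ N, P (N + 1) = P N + u N := fun N ↦ sum_range_succ u N
  -- first cut point
  have hex₁ : ∃ N, S / 3 ≤ P N :=
    ((htend.eventually (eventually_gt_nhds (by linarith : S / 3 < S))).mono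
      fun N hN ↦ hN.le).exists
  set N₁ := Nat.find hex₁ with hN₁
  have h₁ : S / 3 ≤ P N₁ := Nat.find_spec hex₁
  have hN₁0 : N₁ ≠ 0 := by
    intro h0
    rw [h0] at h₁
    simp [hP] at h₁
    linarith
  obtain ⟨M₁, hM₁⟩ := Nat.exists_eq_succ_of_ne_zero hN₁0
  have h₁' : P M₁ < S / 3 := by
    have := Nat.find_min hex₁ (show M₁ < N₁ by omega)
    exact not_le.1 this
  have h₁u : P N₁ ≤ S / 3 + 1 := by
    rw [hM₁, hstep]
    linarith [hu1 M₁]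
  -- second cut point
  have hex₂ : ∃ N, P N₁ + S / 3 ≤ P N :=
    ((htend.eventually (eventually_gt_nhds (by linarith : P N₁ + S / 3 < S))).mono
      fun N hN ↦ hN.le).exists
  set N₂ := Nat.find hex₂ with hN₂
  have h₂ : P N₁ + S / 3 ≤ P N₂ := Nat.find_spec hex₂
  have hN₂0 : N₂ ≠ 0 := by
    intro h0
    rw [h0] at h₂
    have hPN₁ : 0 ≤ P N₁ := sum_nonneg fun n _ ↦ hu0 n
    simp [hP] at h₂
    linarith
  obtain ⟨M₂, hM₂⟩ := Nat.exists_eq_succ_of_ne_zero hN₂0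
  have h₂' : P M₂ < P N₁ + S / 3 := by
    have := Nat.find_min hex₂ (show M₂ < N₂ by omega)
    exact not_le.1 this
  have h₂u : P N₂ ≤ P N₁ + S / 3 + 1 := by
    rw [hM₂, hstep]
    linarith [hu1 M₂]
  have hle : N₁ ≤ N₂ := by
    by_contra h
    have := sum_range_mono hu0 (le_of_lt (not_le.1 h))
    change P N₂ ≤ P N₁ at this
    linarith
  refine ⟨N₁, N₂, hle, h₁, h₁u, ?_, ?_⟩
  · rw [sum_Ico_eq_sub _ hle]
    change S / 3 ≤ P N₂ - P N₁
    linarith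
  · rw [sum_Ico_eq_sub _ hle]
    change P N₂ - P N₁ ≤ S / 3 + 1
    linarith

/-! ### The two-circle linkage (law of cosines) -/

/-- `‖x + iy‖ = 1` for `y = √(1 − x²)` and `x² ≤ 1`. [folklore] -/
theorem norm_ofReal_add_sqrt_mul_I {x : ℝ} (hx : x ^ 2 ≤ 1) :
    ‖(x : ℂ) + (Real.sqrt (1 - x ^ 2) : ℂ) * I‖ = 1 := by
  rw [norm_add_mul_I, Real.sq_sqrt (by linarith), add_sub_cancel, Real.sqrt_one]

/-- **The two-circle linkage.** For `a, b > 0` there are `ε₁, ε₂ : ℂ → ℂ`, continuous on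
`{c ≠ 0}`, such that for every `c ≠ 0` with `|‖c‖ − a| ≤ b ≤ ‖c‖ + a` (the triangle
inequalities for side lengths `a, b, ‖c‖`): `‖ε₁ c‖ = ‖ε₂ c‖ = 1` and `a ε₁(c) + b ε₂(c) = c`.
(`ε₁ = (c/‖c‖)(x + i√(1 − x²))` with `x = (‖c‖² + a² − b²)/(2a‖c‖)` by the law of cosines, and
`ε₂ = (c − a ε₁)/b`.) The source solves `λ₁e^{iu₁} + λ₂e^{−iu₂} = λ₀ − w_a/S_a` continuously in
the parameter. [cite: SaiasWeingartner2009, Lemma 1 (proof)] -/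
theorem exists_twoCircle {a b : ℝ} (ha : 0 < a) (hb : 0 < b) :
    ∃ ε₁ ε₂ : ℂ → ℂ, ContinuousOn ε₁ {c | c ≠ 0} ∧ ContinuousOn ε₂ {c | c ≠ 0} ∧
      ∀ c : ℂ, c ≠ 0 → |‖c‖ - a| ≤ b → b ≤ ‖c‖ + a →
        ‖ε₁ c‖ = 1 ∧ ‖ε₂ c‖ = 1 ∧ (a : ℂ) * ε₁ c + b * ε₂ c = c := by
  set x : ℂ → ℝ := fun c ↦ (‖c‖ ^ 2 + a ^ 2 - b ^ 2) / (2 * a * ‖c‖) with hx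
  set u : ℂ → ℂ := fun c ↦ (x c : ℂ) + (Real.sqrt (1 - x c ^ 2) : ℂ) * I with hu
  set ε₁ : ℂ → ℂ := fun c ↦ c / (‖c‖ : ℂ) * u c with hε₁
  set ε₂ : ℂ → ℂ := fun c ↦ (c - a * ε₁ c) / b with hε₂
  -- continuity
  have hxc : ContinuousOn x {c : ℂ | c ≠ 0} := by
    refine ContinuousOn.div (by fun_prop) (by fun_prop) fun c hc ↦ ?_
    have : ‖c‖ ≠ 0 := norm_ne_zero_iff.2 hc
    positivity
  have huc : ContinuousOn u {c : ℂ | c ≠ 0} := by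
    refine ContinuousOn.add (continuous_ofReal.comp_continuousOn hxc) (ContinuousOn.mul ?_
      continuousOn_const)
    exact continuous_ofReal.comp_continuousOn ((Real.continuous_sqrt.comp_continuousOn
      (continuousOn_const.sub (hxc.pow 2))))
  have hε₁c : ContinuousOn ε₁ {c : ℂ | c ≠ 0} := by
    refine ContinuousOn.mul (ContinuousOn.div continuousOn_id
      (continuous_ofReal.comp_continuousOn continuous_norm.continuousOn) fun c hc ↦ ?_) huc
    exact_mod_cast norm_ne_zero_iff.2 hc
  have hε₂c : ContinuousOn ε₂ {c : ℂ | c ≠ 0} :=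
    ((continuousOn_id.sub (continuousOn_const.mul hε₁c)).div_const _)
  refine ⟨ε₁, ε₂, hε₁c, hε₂c, fun c hc h1 h2 ↦ ?_⟩
  have hcn : 0 < ‖c‖ := norm_pos_iff.2 hc
  have hcn' : (‖c‖ : ℂ) ≠ 0 := by exact_mod_cast hcn.ne'
  -- `x² ≤ 1` from the triangle inequalities
  have hx2 : x c ^ 2 ≤ 1 := by
    have hxle : x c ≤ 1 := by
      rw [hx]
      dsimp only
      rw [div_le_one (by positivity)]
      have : (‖c‖ - a) ^ 2 ≤ b ^ 2 := by
        calc (‖c‖ - a) ^ 2 = |‖c‖ - a| ^ 2 := (sq_abs _).symm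
          _ ≤ b ^ 2 := pow_le_pow_left₀ (abs_nonneg _) h1 2
      nlinarith
    have hxge : -1 ≤ x c := by
      rw [hx]
      dsimp only
      rw [le_div_iff₀ (by positivity)]
      have : b ^ 2 ≤ (‖c‖ + a) ^ 2 := pow_le_pow_left₀ hb.le h2 2
      nlinarith
    nlinarith
  have hunorm : ‖u c‖ = 1 := norm_ofReal_add_sqrt_mul_I hx2
  have hdnorm : ‖c / (‖c‖ : ℂ)‖ = 1 := by
    rw [norm_div, Complex.norm_real, Real.norm_eq_abs, abs_of_pos hcn, div_self hcn.ne']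
  have hε₁n : ‖ε₁ c‖ = 1 := by
    rw [hε₁]
    dsimp only
    rw [norm_mul, hdnorm, hunorm, mul_one]
  -- `‖c − a ε₁‖ = b`
  have hkey : 2 * a * ‖c‖ * x c = ‖c‖ ^ 2 + a ^ 2 - b ^ 2 := by
    rw [hx]
    field_simp
  have hy2 : Real.sqrt (1 - x c ^ 2) ^ 2 = 1 - x c ^ 2 := Real.sq_sqrt (by linarith)
  have hdiff : c - a * ε₁ c = c / (‖c‖ : ℂ) *
      (((‖c‖ - a * x c : ℝ) : ℂ) + ((-(a * Real.sqrt (1 - x c ^ 2)) : ℝ) : ℂ) * I) := by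
    rw [hε₁]
    dsimp only
    rw [hu]
    dsimp only
    push_cast
    field_simp
    ring
  have hnorm_diff : ‖c - a * ε₁ c‖ = b := by
    rw [hdiff, norm_mul, hdnorm, one_mul, norm_add_mul_I]
    have : (‖c‖ - a * x c) ^ 2 + (-(a * Real.sqrt (1 - x c ^ 2))) ^ 2 = b ^ 2 := by
      nlinarith [hkey, hy2]
    rw [this, Real.sqrt_sq hb.le]
  have hε₂n : ‖ε₂ c‖ = 1 := by
    rw [hε₂]
    dsimp only
    rw [norm_div, hnorm_diff, Complex.norm_real, Real.norm_eq_abs, abs_of_pos hb, div_self hb.ne']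
  refine ⟨hε₁n, hε₂n, ?_⟩
  rw [hε₂]
  dsimp only
  have hb' : (b : ℂ) ≠ 0 := by exact_mod_cast hb.ne'
  field_simp
  ring

/-! ### Inverting the character matrix -/

/-- **Inverting the character matrix** (orthogonality of distinct characters): for pairwise
distinct Dirichlet characters `ψⱼ mod q` and `W_a = φ(q)⁻¹ ∑ⱼ ψⱼ⁻¹(a) wⱼ`, `∑_a ψᵢ(a) W_a = wᵢ`
(the sum over all `a ∈ ℤ/qℤ`; non-units contribute `0`). [folklore] -/
theorem sum_char_mul_charInv_transform {q : ℕ} [NeZero q] {ι : Type*} [Fintype ι]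
    (ψ : ι → DirichletCharacter ℂ q) (hψ : Function.Injective ψ) (w : ι → ℂ) (i : ι) :
    ∑ a : ZMod q, ψ i a * ((q.totient : ℂ)⁻¹ * ∑ j, (ψ j)⁻¹ a * w j) = w i := by
  classical
  have hφ : (q.totient : ℂ) ≠ 0 := by exact_mod_cast (Nat.totient_pos.2 (NeZero.pos q)).ne'
  have horth : ∀ j, ∑ a : ZMod q, ψ i a * (ψ j)⁻¹ a = if j = i then (q.totient : ℂ) else 0 := by
    intro j
    have e : ∀ a : ZMod q, ψ i a * (ψ j)⁻¹ a = (ψ i * (ψ j)⁻¹) a := fun a ↦ by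
      rw [MulChar.coeToFun_mul, Pi.mul_apply]
    simp_rw [e]
    split_ifs with hji
    · subst hji
      rw [mul_inv_cancel, MulChar.sum_one_eq_card_units, ZMod.card_units_eq_totient]
    · refine MulChar.sum_eq_zero_of_ne_one fun h ↦ hji ?_
      exact (hψ (mul_inv_eq_one.1 h)).symm
  have e2 : ∀ a : ZMod q, ψ i a * ((q.totient : ℂ)⁻¹ * ∑ j, (ψ j)⁻¹ a * w j) =
      ∑ j, (q.totient : ℂ)⁻¹ * w j * (ψ i a * (ψ j)⁻¹ a) := by
    intro a
    rw [Finset.mul_sum, Finset.mul_sum]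
    exact Finset.sum_congr rfl fun j _ ↦ by ring
  rw [Finset.sum_congr rfl fun a _ ↦ e2 a, Finset.sum_comm]
  simp_rw [← Finset.mul_sum, horth, mul_ite, mul_zero]
  rw [Finset.sum_ite_eq' Finset.univ i, if_pos (Finset.mem_univ i)]
  field_simp

/-- The transformed vector is bounded by `∑ⱼ ‖wⱼ‖` (`|ψ⁻¹(a)| ≤ 1`, `φ(q) ≥ 1`). [folklore] -/
theorem norm_charInv_transform_le {q : ℕ} [NeZero q] {ι : Type*} [Fintype ι]
    (ψ : ι → DirichletCharacter ℂ q) (w : ι → ℂ) (a : ZMod q) :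
    ‖(q.totient : ℂ)⁻¹ * ∑ j, (ψ j)⁻¹ a * w j‖ ≤ ∑ j, ‖w j‖ := by
  have hφ1 : (1 : ℝ) ≤ q.totient := by exact_mod_cast Nat.totient_pos.2 (NeZero.pos q)
  rw [norm_mul, norm_inv, Complex.norm_natCast]
  calc (q.totient : ℝ)⁻¹ * ‖∑ j, (ψ j)⁻¹ a * w j‖ ≤ 1 * ∑ j, ‖w j‖ := by
        refine mul_le_mul (inv_le_one_of_one_le₀ hφ1) ((norm_sum_le _ _).trans
          (Finset.sum_le_sum fun j _ ↦ ?_)) (norm_nonneg _) zero_le_one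
        rw [norm_mul]
        exact mul_le_of_le_one_left (norm_nonneg _) (DirichletCharacter.norm_le_one _ _)
    _ = ∑ j, ‖w j‖ := one_mul _

end SaiasWeingartner

end Literature.NumberTheory.LFunctions
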